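import Literature.Barriers.CriticalPhenomena.LaceExpansionGaussianLargeT
import Literature.Barriers.CriticalPhenomena.HaraGaussianLemmaSmallTime
import HarnessLib

/-!
# Hara's Gaussian lemma, Theorem 1.3: the named fact `Hara2008_thm13` discharged

Barrier catalogue `Literature/Barriers/CriticalPhenomena/` (D-0021). Sibling proof file of
`LaceExpansionGaussianLemma.lean`, which vendors Hara 2008, Thm. 1.3 (second half, with the error
bound (1.20a)) as the named fact `Hara2008_thm13`. Its printed proof (Hara 2008, §2) is in the tree
in full, spread over files that cannot be imported by the vendoring file itself:

* §2.1, (2.1)–(2.2): `C(x) = ∫₀^∞ I_t(x) dt` — `haraC_eq_integral_haraI`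
  (`LaceExpansionGaussianHeatKernel.lean`);
* §2.3 with §2.6, Lemma 2.2 (large `t`) in the quantitative form
  `|I_t(x) - (d/(2πK₁t))^{d/2}e^{-d|x|²/(2tK₁)}| ≤ c t^{-(d+ρ∧2)/2}` (`t ≥ 1`) — `Hara2008_lem22_holds`
  (`LaceExpansionGaussianLargeT.lean`);
* §2.4, Lemma 2.3 (small `t`), case `m = d`, `n⃗ = 0⃗`: `|I_t(x)| ≤ c₆⟦x⟧^{-d}` —
  `Hara2008_lem23_holds` (`HaraGaussianLemmaSmallTime.lean`, on `HaraGaussianLemmaHeatKernel.lean`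
  and `HaraGaussianLemmaTorusIBP.lean`);
* §2.1 (2.3)–(2.8) with `T = |x|^{2-(ρ∧2)/d}` of §2.6 (2.47)–(2.49) and the Gaussian time
  integrals — `Hara2008_thm13_of_lemmas : Hara2008_lem22 → Hara2008_lem23 → Hara2008_thm13`
  (`LaceExpansionGaussianLemmaAssembly.lean`).

This file assembles them into `Hara2008_thm13_holds`. Downstream, `Hara2008_gaussianConvolution`
(Cor. 1.4) follows by `Hara2008_gaussianConvolution_of_thm13`, and in the reduction
`Hara2008_etaZeroXSpace_of_thm13` (Heydenreich–van der Hofstad 2017, Thm. 11.4) only the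
lace-expansion input `Hara2008_laceExpansionPc` remains a named fact.

## References

* T. Hara, *Decay of correlations in nearest-neighbor self-avoiding walk, percolation, lattice
  trees and animals*, Ann. Probab. 36 (2008) 530–593 (arXiv:math-ph/0504021): Thm. 1.3
  ((1.18)–(1.20a)); §2 (§2.1 overview (2.1)–(2.8), Lemma 2.2, Lemma 2.3, §2.6).
-/

noncomputable section

namespace Literature.Barriers.CriticalPhenomena

/-- **Hara 2008, Theorem 1.3 (quantitative half (1.20a)), proved**: for `d ≥ 3` and a
`ℤ^d`-symmetric kernel `J` obeying (1.18)–(1.19) and (1.19') (`HaraKernelHyp d J ρ`),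
`C(x) = (a_d/K₁)|x|^{2-d} + O(|x|^{-(d-2+(ρ∧2)/d)})` — the named fact `Hara2008_thm13`, obtained
from the proved framework `Hara2008_thm13_of_lemmas` (§2.1 with the `T` of §2.6) fed with the
proved Lemma 2.2 (`Hara2008_lem22_holds`) and Lemma 2.3 (`Hara2008_lem23_holds`).
[cite: Hara2008, Thm. 1.3 ((1.18)–(1.20a)); proof §2 (Lemma 2.2, Lemma 2.3, §2.1, §2.6)] -/
theorem Hara2008_thm13_holds : Hara2008_thm13 :=
  Hara2008_thm13_of_lemmas Hara2008_lem22_holds Hara2008_lem23_holds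

end Literature.Barriers.CriticalPhenomena
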